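import Mathlib
import HarnessLib
import Summits.AnomalousDissipation.AnomalousDissipation.Theses.DecimationAxis

/-!
# Sketch for STUB-IDEAS-stub_uniformSettling-3 (FAMILY 3 — probe the extremes)

Helper-lemma SIGNATURES only (every `theorem` here is `sorry`; this file is an elaboration check of
the statements quoted in `STUB-IDEAS-stub_uniformSettling-3.md`, not a proof attempt). Vocabulary
(`IsCoeffTrajectory`, `modalEnergy`, `resolvedDissipation`, `Sig_stub_uniformSettling`) copied VERBATIM
from `Cruxes/UniformEquilibration/Lines/birth.lean` (Cruxes files are not importable).
-/

set_option linter.dupNamespace false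
set_option linter.unusedVariables false

noncomputable section

namespace Summit.AnomalousDissipation.AnomalousDissipation.Cruxes.UniformEquilibration.StubIdeasUniformSettling3

open scoped BigOperators Topology Classical MeasureTheory InnerProductSpace ComplexConjugate
open Filter Set Function MeasureTheory
open Literature.Analysis.FunctionSpaces Literature.Analysis.FunctionSpaces.Torus
open Literature.Analysis.FluidPDE Literature.Analysis.FluidPDE.Torus
open Summit.AnomalousDissipation.AnomalousDissipation.Theses.DecimationAxis

local notation "ℤ³" => Fin 3 → ℤ
local notation "ℂ³" => EuclideanSpace ℂ (Fin 3)

/-! ### §0 Vocabulary (verbatim from `Lines/birth.lean`) -/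

def IsCoeffTrajectory (S : Finset ℤ³) (ν : ℝ) (g : ℤ³ → ℂ³) (c : ℝ → ↥S → ℂ³) : Prop :=
  (∀ t, c t ∈ galerkinSubspace S) ∧ ContinuousOn c (Set.Ici 0) ∧
    ∀ T : ℝ, ∀ t ∈ Set.Icc (0 : ℝ) T,
      HasDerivWithinAt c (galerkinRHS S ν (fun k => g k) (c t)) (Set.Icc 0 T) t

def modalEnergy {S : Finset ℤ³} (a : ↥S → ℂ³) : ℝ :=
  ∑ k : ↥S, ‖a k‖ ^ 2

def resolvedDissipation {S : Finset ℤ³} (ν : ℝ) (M : ℕ) (a : ↥S → ℂ³) : ℝ :=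
  ν * (4 * Real.pi ^ 2 * ∑ k : ↥S,
    if freqNormSq (k : ℤ³) ≤ (M : ℝ) ^ 2 then freqNormSq (k : ℤ³) * ‖a k‖ ^ 2 else 0)

/-- The four admissibility hypotheses on the force family, bundled (abbreviation for this file). -/
def Admissible (N : ℕ) (g : ℤ³ → ℂ³) : Prop :=
  IsConjSymm g ∧ (∀ k, k ∉ freqBall N → g k = 0) ∧ g 0 = 0 ∧
    (∀ k : ℤ³, ∑ i, ((k i : ℤ) : ℂ) * g k i = 0)

/-- The premise of the stub at truncation `S` (a Floor witness inside the ball `B`). -/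
def Premise (S : Finset ℤ³) (ν : ℝ) (g : ℤ³ → ℂ³) (E ε : ℝ) (M : ℕ) (B : ℝ) : Prop :=
  ∃ c : ℝ → ↥S → ℂ³, IsCoeffTrajectory S ν g c ∧ (∀ t, 0 ≤ t → modalEnergy (c t) ≤ B) ∧
    longTimeAvgSup (fun t => modalEnergy (c t)) ≤ E ∧
    2 * ε ≤ longTimeAvgInf (fun t => resolvedDissipation ν M (c t))

/-- The conclusion of the stub at truncation `S` for given `(T₁, E₁, ε₁, B₁)`. -/
def Settled (S : Finset ℤ³) (ν : ℝ) (g : ℤ³ → ℂ³) (M : ℕ) (T₁ E₁ ε₁ B₁ : ℝ) : Prop :=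
  ∃ c : ℝ → ↥S → ℂ³, IsCoeffTrajectory S ν g c ∧ (∀ t, 0 ≤ t → modalEnergy (c t) ≤ B₁) ∧
    ∀ T : ℝ, T₁ ≤ T →
      timeMean (fun t => modalEnergy (c t)) T ≤ E₁ ∧
      ε₁ ≤ timeMean (fun t => resolvedDissipation ν M (c t)) T

/-- The registered stub, verbatim (= `Birth.Sig.stub_uniformSettling`). -/
def Sig_stub_uniformSettling : Prop :=
  ∀ (ν : ℝ), 0 < ν → ∀ (N : ℕ) (g : ℤ³ → ℂ³), IsConjSymm g → (∀ k, k ∉ freqBall N → g k = 0) →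
    g 0 = 0 → (∀ k : ℤ³, ∑ i, ((k i : ℤ) : ℂ) * g k i = 0) →
    ∀ (E ε : ℝ) (M : ℕ) (B : ℝ), 0 < ε →
      ∃ (T₁ E₁ ε₁ B₁ : ℝ), E₁ < 2 * E ∧ ε < ε₁ ∧
        ∀ (K : ℕ) (S : Finset ℤ³), S = (freqBall K).erase 0 →
          (∃ c : ℝ → ↥S → ℂ³, IsCoeffTrajectory S ν g c ∧ (∀ t, 0 ≤ t → modalEnergy (c t) ≤ B) ∧
              longTimeAvgSup (fun t => modalEnergy (c t)) ≤ E ∧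
              2 * ε ≤ longTimeAvgInf (fun t => resolvedDissipation ν M (c t))) →
          ∃ c : ℝ → ↥S → ℂ³, IsCoeffTrajectory S ν g c ∧ (∀ t, 0 ≤ t → modalEnergy (c t) ≤ B₁) ∧
              ∀ T : ℝ, T₁ ≤ T →
                timeMean (fun t => modalEnergy (c t)) T ≤ E₁ ∧
                ε₁ ≤ timeMean (fun t => resolvedDissipation ν M (c t)) T

/-- Sanity: the `Premise`/`Settled` packaging is definitionally the stub. -/
theorem sig_iff_packaged :
    Sig_stub_uniformSettling ↔
      ∀ (ν : ℝ), 0 < ν → ∀ (N : ℕ) (g : ℤ³ → ℂ³), IsConjSymm g →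
        (∀ k, k ∉ freqBall N → g k = 0) → g 0 = 0 →
        (∀ k : ℤ³, ∑ i, ((k i : ℤ) : ℂ) * g k i = 0) →
        ∀ (E ε : ℝ) (M : ℕ) (B : ℝ), 0 < ε →
          ∃ (T₁ E₁ ε₁ B₁ : ℝ), E₁ < 2 * E ∧ ε < ε₁ ∧
            ∀ (K : ℕ) (S : Finset ℤ³), S = (freqBall K).erase 0 →
              Premise S ν g E ε M B → Settled S ν g M T₁ E₁ ε₁ B₁ :=
  Iff.rfl

/-! ### §1 Plan A — one observable SELECTED along the witness (pure real analysis, one cycle each)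

S1/S2 are F. Riesz's rising-sun lemma in its "global minimiser of a drifting primitive" form:
`H(t) = ∫₀ᵗ (E₁' − e)` (resp. `F(t) = ∫₀ᵗ (D − ε₁')`) is continuous and `→ +∞`, so it attains its
minimum on `[s₀, ∞)` at some `s`, and `H(s+T) ≥ H(s)` for all `T ≥ 0` is exactly the conclusion.
Mathlib: `ContinuousOn.exists_isMinOn'` + `intervalIntegral.integral_comp_add_right`. -/

/-- **S1 (sunrise selection, energy side).** A bounded nonnegative observable whose long-time
`limsup` mean is `≤ E < E₁'` admits, beyond any `s₀`, a start from which EVERY forward mean is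
`≤ E₁'` (no settling time at all). -/
theorem sunrise_select {φ : ℝ → ℝ} {B E E₁' s₀ : ℝ}
    (hφ0 : ∀ t, 0 ≤ φ t) (hφB : ∀ t, 0 ≤ t → φ t ≤ B) (hφc : ContinuousOn φ (Set.Ici 0))
    (hE : longTimeAvgSup φ ≤ E) (hE₁ : E < E₁') (hs₀ : 0 ≤ s₀) :
    ∃ s : ℝ, s₀ ≤ s ∧ ∀ T : ℝ, 0 < T → timeMean (fun t => φ (t + s)) T ≤ E₁' := by
  sorry

/-- **S2 (rising-sun selection, dissipation side).** Twin of S1: a bounded nonnegative observable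
with long-time `liminf` mean `≥ ε₂ > ε₁'` admits, beyond any `s₀`, a start from which EVERY forward
mean is `≥ ε₁'`. -/
theorem risingSun_select {ψ : ℝ → ℝ} {D ε₂ ε₁' s₀ : ℝ}
    (hψ0 : ∀ t, 0 ≤ ψ t) (hψD : ∀ t, 0 ≤ t → ψ t ≤ D) (hψc : ContinuousOn ψ (Set.Ici 0))
    (hε : ε₂ ≤ longTimeAvgInf ψ) (hε₁ : ε₁' < ε₂) (hs₀ : 0 ≤ s₀) :
    ∃ s : ℝ, s₀ ≤ s ∧ ∀ T : ℝ, 0 < T → ε₁' ≤ timeMean (fun t => ψ (t + s)) T := by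
  sorry

/-- **S3 (tilted selection ⇒ the low-intermittency extreme).** Rising sun applied to the single
functional `D − λ e`: if the witness's POINTWISE dissipation never exceeds `D' < 3ε` (fluctuations of
`D` below 50 % of its guaranteed mean level `2ε`), one start controls BOTH means for all `T > 0`,
with margins `E₁ < 2E`, `ε₁ > ε`. (Choose `λ ∈ ((D'−2ε+δ)/E, (ε−δ)/E)`, nonempty iff `D' < 3ε − 2δ`.) -/
theorem lowIntermittency_select {φ ψ : ℝ → ℝ} {B D' E ε s₀ : ℝ}
    (hφ0 : ∀ t, 0 ≤ φ t) (hφB : ∀ t, 0 ≤ t → φ t ≤ B) (hφc : ContinuousOn φ (Set.Ici 0))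
    (hψ0 : ∀ t, 0 ≤ ψ t) (hψD : ∀ t, 0 ≤ t → ψ t ≤ D') (hψc : ContinuousOn ψ (Set.Ici 0))
    (hE : longTimeAvgSup φ ≤ E) (hEpos : 0 < E) (hε : 2 * ε ≤ longTimeAvgInf ψ) (hεpos : 0 < ε)
    (hD' : D' < 3 * ε) (hs₀ : 0 ≤ s₀) :
    ∃ E₁ ε₁ : ℝ, E₁ < 2 * E ∧ ε < ε₁ ∧
      ∃ s : ℝ, s₀ ≤ s ∧ ∀ T : ℝ, 0 < T →
        timeMean (fun t => φ (t + s)) T ≤ E₁ ∧ ε₁ ≤ timeMean (fun t => ψ (t + s)) T := by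
  sorry

/-- **W1 (carrying the energy bound across a bounded wait).** If every forward mean of `φ ≥ 0` from
`s` is `≤ E₁'`, then from `s + w` every forward mean is `≤ E₁' (T + w)/T`
(`∫_{s+w}^{s+w+T} φ ≤ ∫_s^{s+w+T} φ`). With S2 this is the WAITING-TIME reduction of Plan C. -/
theorem timeMean_shift_le_of_forall_le {φ : ℝ → ℝ} {E₁' s w : ℝ}
    (hφ0 : ∀ t, 0 ≤ φ t) (hφc : ContinuousOn φ (Set.Ici 0)) (hs : 0 ≤ s) (hw : 0 ≤ w)
    (h : ∀ T : ℝ, 0 < T → timeMean (fun t => φ (t + s)) T ≤ E₁') :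
    ∀ T : ℝ, 0 < T → timeMean (fun t => φ (t + (s + w))) T ≤ E₁' * (T + w) / T := by
  sorry

/-- **W2 (twin: carrying the dissipation bound across a bounded wait, paying `D_max · w`).** -/
theorem timeMean_shift_ge_of_forall_ge {ψ : ℝ → ℝ} {D ε₁' s w : ℝ}
    (hψ0 : ∀ t, 0 ≤ ψ t) (hψD : ∀ t, 0 ≤ t → ψ t ≤ D) (hψc : ContinuousOn ψ (Set.Ici 0))
    (hs : 0 ≤ s) (hw : 0 ≤ w)
    (h : ∀ T : ℝ, 0 < T → ε₁' ≤ timeMean (fun t => ψ (t + s)) T) :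
    ∀ T : ℝ, 0 < T → (ε₁' * (T + w) - D * w) / T ≤ timeMean (fun t => ψ (t + (s + w))) T := by
  sorry

/-! ### §2 Plan A — K-UNIFORM one-sided dynamical bounds (the only dynamics the extremes need) -/

/-- **Q1 (transversal convection bound, K-UNIFORM).** For a divergence-free family the convection
symbol obeys `‖B_k(c,c)‖ ≤ 2π|k| Σ_l ‖c_l‖²` — no `#S`, unlike the tree's crude
`norm_convectionCoeff_le`. (Transversality `l · c_l = 0` gives `c_l · m = c_l · k` for `l + m = k`;
then Cauchy–Schwarz and `Σ_l ‖c_l‖‖c_{k−l}‖ ≤ Σ_l ‖c_l‖²`.) This is what makes every constant below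
independent of the truncation. -/
theorem norm_convectionCoeff_le_of_solenoidal (S : Finset ℤ³) {c : ↥S → ℂ³}
    (hc : c ∈ galerkinSubspace S) (k : ℤ³) :
    ‖convectionCoeff S (coeffExt S c) (coeffExt S c) k‖ ≤
      2 * Real.pi * Real.sqrt (freqNormSq k) * ∑ l : ↥S, ‖c l‖ ^ 2 := by
  sorry

/-- **P0 (vacuity bookkeeping, K-uniform).** If the premise holds at `S = freqBall K ∖ {0}` with
`ε > 0` then `E > 0` and some FORCED, RESOLVED-OR-NOT mode lies in `S` (else injection `≡ 0`,
`e ≤ B e^{−8π²νt}`, `D ≤ 4π²νM² e → 0`, so `longTimeAvgInf D = 0 < 2ε`). Consequently a forced mode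
`k₀` of MINIMAL `freqNormSq` lies in `S` for every `K` at which the premise can hold. -/
theorem premise_forces (ν : ℝ) (hν : 0 < ν) (N : ℕ) (g : ℤ³ → ℂ³) (hg : Admissible N g)
    (E ε : ℝ) (M : ℕ) (B : ℝ) (hε : 0 < ε) (K : ℕ) (S : Finset ℤ³) (hS : S = (freqBall K).erase 0)
    (h : Premise S ν g E ε M B) :
    0 < E ∧ ∃ k ∈ S, g k ≠ 0 := by
  sorry

/-- **Q3 (averaged quiet-phase lemma = K-UNIFORM DISSIPATION FLOOR; one cycle, the dynamical heart of
Plan A(ii)).** Fix `ν > 0`, admissible `g` with a forced mode `k₀` (`g k₀ ≠ 0`), a resolution `M ≥ N`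
(so every forced mode is resolved) and a ball radius `B`. There are `d₀ > 0` and `T⋆`, depending on
`(ν, g, k₀, B)` ONLY, such that for EVERY truncation containing `k₀` and EVERY trajectory in the ball,
every window mean of the resolved dissipation at scale `≥ T⋆` is `≥ d₀`.
Proof in print (no Duhamel, no Gronwall): integrate the `k₀`-equation
`ċ_{k₀} = −λ₀ c_{k₀} + g_{k₀} − Π_{k₀} B_{k₀}(c,c)` (`λ₀ = 4π²ν|k₀|²`, `a = ‖g_{k₀}‖`) over the window
and take norms: `a ≤ 2√B/T + λ₀·mean‖c_{k₀}‖ + 2π|k₀|·mean e` (Q1); `mean‖c_{k₀}‖ ≤ √(mean D/λ₀)`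
(`D ≥ λ₀‖c_{k₀}‖²`, Jensen); the energy identity + Poincaré on `S ∌ 0` + injection
`≤ G √(e_{≤N}) ≤ G √(D/(4π²ν))` (`N ≤ M`) give `mean e ≤ (B/T + 2G√(mean D/(4π²ν)))/(8π²ν)`; so
`a ≤ (2√B + |k₀|B/(4πν))/T + √(mean D)·(√λ₀ + |k₀| G/(4π²ν^{3/2}))`, and
`T⋆ := 4(2√B + |k₀|B/(4πν))/a`, `d₀ := (a / (4(√λ₀ + |k₀|G/(4π²ν^{3/2}))))²` force `a ≤ a/2`.
(In the route's regime `ν → 0`: `d₀ ~ ν³ a²/(|k₀|G)²` — honest but tiny.) -/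
theorem windowMean_resolvedDissipation_floor (ν : ℝ) (hν : 0 < ν) (N : ℕ) (g : ℤ³ → ℂ³)
    (hg : Admissible N g) (M : ℕ) (hNM : N ≤ M) (k₀ : ℤ³) (hk₀ : g k₀ ≠ 0) (B : ℝ) :
    ∃ d₀ : ℝ, 0 < d₀ ∧ ∃ Tstar : ℝ, 0 < Tstar ∧
      ∀ (K : ℕ) (S : Finset ℤ³), S = (freqBall K).erase 0 → k₀ ∈ S →
        ∀ c : ℝ → ↥S → ℂ³, IsCoeffTrajectory S ν g c → (∀ t, 0 ≤ t → modalEnergy (c t) ≤ B) →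
          ∀ s T : ℝ, 0 ≤ s → Tstar ≤ T →
            d₀ ≤ timeMean (fun t => resolvedDissipation ν M (c (t + s))) T := by
  sorry

/-- **SHIFT (autonomy; routine).** Time shifts of trajectories are trajectories and stay in the ball
(cf. `IsGalerkinODESolution.comp_add`). -/
theorem IsCoeffTrajectory.comp_add {S : Finset ℤ³} {ν : ℝ} {g : ℤ³ → ℂ³} {c : ℝ → ↥S → ℂ³}
    (hc : IsCoeffTrajectory S ν g c) {s : ℝ} (hs : 0 ≤ s) :
    IsCoeffTrajectory S ν g (fun t => c (t + s)) := by
  sorry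

/-! ### §3 Plan A — assembly in the three cheap extremes -/

/-- **A(i) ENERGY SLACK** (`B < 2E`; more generally eventual-sup `e < 2E`): rising sun on `D` alone
(S2) + the pointwise ball bound; `T₁ := 1`, `E₁ := max B E`, `ε₁ := 3ε/2`, `B₁ := B`. Unconditional. -/
theorem settled_of_energySlack (ν : ℝ) (hν : 0 < ν) (N : ℕ) (g : ℤ³ → ℂ³) (hg : Admissible N g)
    (E ε : ℝ) (M : ℕ) (B : ℝ) (hε : 0 < ε) (hslack : B < 2 * E) :
    ∃ (T₁ E₁ ε₁ B₁ : ℝ), E₁ < 2 * E ∧ ε < ε₁ ∧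
      ∀ (K : ℕ) (S : Finset ℤ³), S = (freqBall K).erase 0 →
        Premise S ν g E ε M B → Settled S ν g M T₁ E₁ ε₁ B₁ := by
  sorry

/-- **A(ii) DISSIPATION SLACK** (`N ≤ M` and `ε` below the K-uniform floor `d₀(ν,g,B)` of Q3):
sunrise on `e` alone (S1) along the witness, the `D`-side being automatic for EVERY ball trajectory
at scales `≥ T⋆`; `T₁ := T⋆`, `E₁ := 3E/2`, `ε₁ := d₀`, `B₁ := B`. Unconditional in its regime. -/
theorem settled_of_dissipationSlack (ν : ℝ) (hν : 0 < ν) (N : ℕ) (g : ℤ³ → ℂ³)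
    (hg : Admissible N g) (M : ℕ) (hNM : N ≤ M) (B : ℝ) :
    ∃ d₀ : ℝ, 0 < d₀ ∧ ∀ (E ε : ℝ), 0 < ε → ε < d₀ →
      ∃ (T₁ E₁ ε₁ B₁ : ℝ), E₁ < 2 * E ∧ ε < ε₁ ∧
        ∀ (K : ℕ) (S : Finset ℤ³), S = (freqBall K).erase 0 →
          Premise S ν g E ε M B → Settled S ν g M T₁ E₁ ε₁ B₁ := by
  sorry

/-- **A(iii) LOW INTERMITTENCY** (a witness whose pointwise resolved dissipation stays `< 3ε`
eventually): S3; `T₁ := 1`. Stated as the implication it adds to the stub's inner body. -/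
theorem settled_of_lowIntermittency (ν : ℝ) (hν : 0 < ν) (N : ℕ) (g : ℤ³ → ℂ³)
    (hg : Admissible N g) (E ε : ℝ) (M : ℕ) (B D' : ℝ) (hε : 0 < ε) (hD' : D' < 3 * ε) :
    ∃ (T₁ E₁ ε₁ B₁ : ℝ), E₁ < 2 * E ∧ ε < ε₁ ∧
      ∀ (K : ℕ) (S : Finset ℤ³), S = (freqBall K).erase 0 →
        (∃ c : ℝ → ↥S → ℂ³, IsCoeffTrajectory S ν g c ∧ (∀ t, 0 ≤ t → modalEnergy (c t) ≤ B) ∧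
            (∀ t, 0 ≤ t → resolvedDissipation ν M (c t) ≤ D') ∧
            longTimeAvgSup (fun t => modalEnergy (c t)) ≤ E ∧
            2 * ε ≤ longTimeAvgInf (fun t => resolvedDissipation ν M (c t))) →
        Settled S ν g M T₁ E₁ ε₁ B₁ := by
  sorry

/-! ### §4 Plan B — the laminar extreme (energy-stability regime; K-uniform by Q1) -/

/-- **L1 (energy stability is K-uniform).** If `U` is an EXACT steady state of the Galerkin system on
`S` and `Λ := 2π Σ_{m∈S} |m| ‖U_m‖ < 4π²ν`, every trajectory converges to `U` exponentially at the
K-independent rate `2(4π²ν − Λ)` (`d/dt‖w‖² = 2(−ν‖∇w‖² − b(w,U,w))`, `|b(w,U,w)| ≤ Λ‖w‖²` by the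
computation behind Q1, Poincaré on `S ∌ 0`). Doering–Gibbon 1995 §2.2 (2.2.17)–(2.2.19); Serrin 1959. -/
theorem energyStable_attracts (ν : ℝ) (hν : 0 < ν) (K : ℕ) (S : Finset ℤ³)
    (hS : S = (freqBall K).erase 0) (g : ℤ³ → ℂ³) (U : ↥S → ℂ³) (hU : U ∈ galerkinSubspace S)
    (hsteady : galerkinRHS S ν (fun k => g k) U = 0) (Λ : ℝ)
    (hΛ : 2 * Real.pi * ∑ m : ↥S, Real.sqrt (freqNormSq (m : ℤ³)) * ‖U m‖ ≤ Λ)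
    (hΛν : Λ < 4 * Real.pi ^ 2 * ν)
    (c : ℝ → ↥S → ℂ³) (hc : IsCoeffTrajectory S ν g c) :
    ∀ t, 0 ≤ t →
      ∑ k : ↥S, ‖c t k - U k‖ ^ 2 ≤
        Real.exp (-(2 * (4 * Real.pi ^ 2 * ν - Λ)) * t) * ∑ k : ↥S, ‖c 0 k - U k‖ ^ 2 := by
  sorry

/-- **L2 (the stub in the energy-stable regime, K-uniform).** If for every truncation the system has a
steady state with energy-stability margin `Λ < 4π²ν` (ONE `Λ` for all `K` — e.g. band-limited
Beltrami/Kolmogorov-type forces whose Stokes state is NS-steady, or any admissible `g` at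
`ν ≥ ν₀(g)` via a K-uniform weighted-`ℓ¹` fixed point), then the premise forces
`e(U) ≤ E`, `D_M(U) ≥ 2ε` (means along a convergent trajectory converge), and the CONSTANT trajectory
`U` settles at once: `T₁ := 1`, `E₁ := E`, `ε₁ := 3ε/2`. -/
theorem settled_of_energyStable (ν : ℝ) (hν : 0 < ν) (N : ℕ) (g : ℤ³ → ℂ³) (hg : Admissible N g)
    (Λ : ℝ) (hΛν : Λ < 4 * Real.pi ^ 2 * ν)
    (hlam : ∀ (K : ℕ) (S : Finset ℤ³), S = (freqBall K).erase 0 →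
      ∃ U : ↥S → ℂ³, U ∈ galerkinSubspace S ∧ galerkinRHS S ν (fun k => g k) U = 0 ∧
        2 * Real.pi * ∑ m : ↥S, Real.sqrt (freqNormSq (m : ℤ³)) * ‖U m‖ ≤ Λ)
    (E ε : ℝ) (M : ℕ) (B : ℝ) (hε : 0 < ε) :
    ∃ (T₁ E₁ ε₁ B₁ : ℝ), E₁ < 2 * E ∧ ε < ε₁ ∧
      ∀ (K : ℕ) (S : Finset ℤ³), S = (freqBall K).erase 0 →
        Premise S ν g E ε M B → Settled S ν g M T₁ E₁ ε₁ B₁ := by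
  sorry

/-! ### §5 Plan C — the tight core in normal form: two typed residual hypotheses and their reductions -/

/-- **UWT (K-uniform waiting time)** — the EXACT residue left by Plans A/B, typed: some sunrise
instant `s` of the energy (all forward `e`-means `≤ E₁'`) is followed within a K-UNIFORM wait `w` by a
rising-sun instant `s'` of the dissipation (all forward `D`-means `≥ ε₁'`), along every ball witness. -/
def UniformWaitingTime (ν : ℝ) (N : ℕ) (g : ℤ³ → ℂ³) (E ε : ℝ) (M : ℕ) (B : ℝ) : Prop :=
  ∃ (w E₁' ε₁' : ℝ), 0 ≤ w ∧ E₁' < 2 * E ∧ ε < ε₁' ∧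
    ∀ (K : ℕ) (S : Finset ℤ³), S = (freqBall K).erase 0 →
      ∀ c : ℝ → ↥S → ℂ³, IsCoeffTrajectory S ν g c → (∀ t, 0 ≤ t → modalEnergy (c t) ≤ B) →
        longTimeAvgSup (fun t => modalEnergy (c t)) ≤ E →
        2 * ε ≤ longTimeAvgInf (fun t => resolvedDissipation ν M (c t)) →
        ∃ s s' : ℝ, 0 ≤ s ∧ s ≤ s' ∧ s' ≤ s + w ∧
          (∀ T : ℝ, 0 < T → timeMean (fun t => modalEnergy (c (t + s))) T ≤ E₁') ∧
          (∀ T : ℝ, 0 < T → ε₁' ≤ timeMean (fun t => resolvedDissipation ν M (c (t + s'))) T)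

/-- **C1: UWT ⇒ the stub's inner body** (W1 with `E₁ := (E₁' + 2E)/2`,
`T₁ := w E₁'/(E₁ − E₁') + 1`, `B₁ := B`; one cycle, pure bookkeeping). -/
theorem settled_of_uniformWaitingTime (ν : ℝ) (hν : 0 < ν) (N : ℕ) (g : ℤ³ → ℂ³)
    (hg : Admissible N g) (E ε : ℝ) (M : ℕ) (B : ℝ) (hε : 0 < ε)
    (h : UniformWaitingTime ν N g E ε M B) :
    ∃ (T₁ E₁ ε₁ B₁ : ℝ), E₁ < 2 * E ∧ ε < ε₁ ∧
      ∀ (K : ℕ) (S : Finset ℤ³), S = (freqBall K).erase 0 →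
        Premise S ν g E ε M B → Settled S ν g M T₁ E₁ ε₁ B₁ := by
  sorry

/-- **HF (half-floor: a ONE-observable, trajectory-uniform sufficient condition).** Every ball
trajectory dissipates, on every window of length `≥ τ`, at least `(1/2 + θ)` of what ANY ball trajectory
dissipates in the long run — K-uniformly. The factor `1/2` is exactly the stub's `2ε ↦ ε` slack; Q3
proves the weak version with the absolute floor `d₀` in place of `(1/2+θ)·liminf`. -/
def HalfFloor (ν : ℝ) (N : ℕ) (g : ℤ³ → ℂ³) (M : ℕ) (B : ℝ) : Prop :=
  ∃ (θ τ : ℝ), 0 < θ ∧ 0 < τ ∧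
    ∀ (K : ℕ) (S : Finset ℤ³), S = (freqBall K).erase 0 →
      ∀ c c' : ℝ → ↥S → ℂ³, IsCoeffTrajectory S ν g c → IsCoeffTrajectory S ν g c' →
        (∀ t, 0 ≤ t → modalEnergy (c t) ≤ B) → (∀ t, 0 ≤ t → modalEnergy (c' t) ≤ B) →
        ∀ s T : ℝ, 0 ≤ s → τ ≤ T →
          (1 / 2 + θ) * longTimeAvgInf (fun t => resolvedDissipation ν M (c t)) ≤
            timeMean (fun t => resolvedDissipation ν M (c' (t + s))) T

/-- **C2: HF ⇒ the stub's inner body** (sunrise S1 on `e` along the witness; `T₁ := τ`,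
`E₁ := 3E/2`, `ε₁ := (1 + 2θ) ε`, `B₁ := B`; one cycle). -/
theorem settled_of_halfFloor (ν : ℝ) (hν : 0 < ν) (N : ℕ) (g : ℤ³ → ℂ³) (hg : Admissible N g)
    (M : ℕ) (B : ℝ) (h : HalfFloor ν N g M B) (E ε : ℝ) (hε : 0 < ε) :
    ∃ (T₁ E₁ ε₁ B₁ : ℝ), E₁ < 2 * E ∧ ε < ε₁ ∧
      ∀ (K : ℕ) (S : Finset ℤ³), S = (freqBall K).erase 0 →
        Premise S ν g E ε M B → Settled S ν g M T₁ E₁ ε₁ B₁ := by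
  sorry

end Summit.AnomalousDissipation.AnomalousDissipation.Cruxes.UniformEquilibration.StubIdeasUniformSettling3
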